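import Mathlib
import HarnessLib

/-!
# Derivatives of Heun functions: Umetsu's differential transformation
# (the Heun-equation form of the Teukolsky–Starobinsky identities on Kerr–de Sitter)

Topic `Literature/Analysis/ODE` (namespace `Literature.Analysis.ODE`, grouping sub-namespace
`GeneralHeun` for the general — four regular singular points `0, 1, a_H, ∞` — Heun operator).

H. Umetsu, Prog. Theor. Phys. 104 (2000) 743–755 [Umetsu2000], §3 "Differential transformations",
eqs. (3.1)–(3.2) (his sign convention: accessory parameter `+q`): for
`M_z(γ,δ,ε;α,β;q) f ≡ { z(z−1)(z−a_H) ∂² + [γ(z−1)(z−a_H) + δ z(z−a_H) + ε z(z−1)] ∂ + αβ z + q } f = 0`,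
"Differentiating this equation `N` times, we obtain
`(d/dz)^N M_z f = { z(z−1)(z−a_H)∂² + [(γ+N)(z−1)(z−a_H) + (δ+N) z(z−a_H) + (ε+N) z(z−1)] ∂`
`  + [3N² + (2α+2β−1)N + αβ] z + q − N(N−1)(a_H+1) − N((a_H+1)γ + a_H δ + ε)`
`  + N(N−1+α)(N−1+β) (∂/∂z)^{−1} } (d/dz)^N f`.
Therefore `f̃(z) = (d/dz)^N f(z)` with `N = 1−α` or `1−β` formally satisfies another Heun's equation
in which the parameters `(γ, δ, ⋯)` are replaced by `γ̃ = γ+N`, `δ̃ = δ+N`, `ε̃ = ε+N`,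
`q̃ = q − N(N−1)(a_H+1) − N((a_H+1)γ + a_H δ + ε)`, and `α̃, β̃` which are determined by relations
`α̃ + β̃ = α + β + 3N` and `α̃β̃ = 3N² + (2α+2β−1)N + αβ`. Here we choose `N = 1−α`. … In both
angular and radial cases, we can take parameters so that `N = |2s|`. These transformations are the
Teukolsky–Starobinsky relations."

This file PROVES Umetsu's display (3.2) as a pointwise identity for smooth classical solutions on an
open set of the real line (`GeneralHeun.iterate`: the Leibniz family for every `N = k+1`, written
with `γ+δ+ε` free; `GeneralHeun.umetsu_identity`: the printed form, which uses the Fuchs relation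
`γ+δ+ε = α+β+1` of a genuine Heun equation), and the transformation theorem
`GeneralHeun.isSolutionOn_iterate_deriv`: if `α = 1 − N` with `N ≥ 1` then `f^{(N)}` is a
classical solution of the Heun equation with parameters
`(a_H; α̃ = N+1, β̃ = β+N; γ+N, δ+N, ε+N; q̃)` — the explicit root pair of Umetsu's two relations
(`GeneralHeun.newExponents_sum`, `GeneralHeun.newExponents_prod`); the Fuchs relation is inherited
(`GeneralHeun.fuchs_shift`).

Real independent variable, complex parameters: this is the setting of the separated Kerr–de Sitter
Teukolsky equations between the event and cosmological horizons in the Heun normalisation of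
Suzuki–Takasugi–Umetsu [SuzukiTakasugiUmetsu1998] §3 (radial Heun parameters with `σ₊ = 2s+1` in
the rôle of `α`), where for spin `s < 0` one has `N = 1 − σ₊ = −2s = |2s|`: in that normalisation
the radial Teukolsky–Starobinsky map `(𝒟)^{2|s|}` of [SuzukiTakasugiUmetsu1999] §4, eq. (4.1), is
the plain `|2s|`-th `z`-derivative — the non-confluent analogue of what
`Literature/Geometry/Lorentzian/TeukolskyStarobinskyHeun.lean` proves for Kerr. NOT done here
(deliberately): the identification of `q̃` with the accessory parameter of the opposite-spin
Kerr–de Sitter radial equation (TODO(KdS-TS): needs the Heun form of the Kerr–de Sitter radial ODE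
as a Literature lemma), and regularity theory (smoothness of `f` on the open set is a hypothesis,
as in the Kerr file). Everything is proved; no named facts are introduced.

## References
* H. Umetsu, *A conserved energy integral for perturbation equations in the Kerr–de Sitter
  geometry*, Prog. Theor. Phys. 104 (2000) 743–755, arXiv:gr-qc/0005037, §3 (3.1)–(3.2).
  Key `Umetsu2000`.
* H. Suzuki, E. Takasugi, H. Umetsu, Prog. Theor. Phys. 100 (1998) 491–505, §3.
  Key `SuzukiTakasugiUmetsu1998`.
* H. Suzuki, E. Takasugi, H. Umetsu, Prog. Theor. Phys. 102 (1999) 253–272, §4 (4.1).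
  Key `SuzukiTakasugiUmetsu1999`.
-/

noncomputable section

open Set Filter
open scoped Topology

namespace Literature.Analysis.ODE

namespace GeneralHeun

/-! ### The Heun operator in Umetsu's normalisation (real variable, complex parameters) -/

/-- Leading coefficient `z(z−1)(z−a_H)` of Umetsu's Heun operator `M_z`, as a function of a real
variable `x` (cast to `ℂ`). [cite: Umetsu2000, §3 (3.1)] -/
def lead (aH : ℂ) (x : ℝ) : ℂ :=
  (x : ℂ) * ((x : ℂ) - 1) * ((x : ℂ) - aH)

/-- First-order coefficient `γ(z−1)(z−a_H) + δ z(z−a_H) + ε z(z−1)` of `M_z`.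
[cite: Umetsu2000, §3 (3.1)] -/
def mid (aH γ δ ε : ℂ) (x : ℝ) : ℂ :=
  γ * (((x : ℂ) - 1) * ((x : ℂ) - aH)) + δ * ((x : ℂ) * ((x : ℂ) - aH)) +
    ε * ((x : ℂ) * ((x : ℂ) - 1))

/-- Zeroth-order coefficient `αβ z + q` of `M_z` (Umetsu's sign of the accessory parameter; the
DLMF form `αβ z − q` is `low α β (−q)`). [cite: Umetsu2000, §3 (3.1)] -/
def low (α β q : ℂ) (x : ℝ) : ℂ :=
  α * β * (x : ℂ) + q

/-- Derivative of `mid`: `γ(2z−1−a_H) + δ(2z−a_H) + ε(2z−1)`. [cite: Umetsu2000, §3 (3.1)–(3.2)] -/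
def midDeriv (aH γ δ ε : ℂ) (x : ℝ) : ℂ :=
  γ * (2 * (x : ℂ) - 1 - aH) + δ * (2 * (x : ℂ) - aH) + ε * (2 * (x : ℂ) - 1)

/-- **Classical solutions of Umetsu's Heun equation** `M_z(γ,δ,ε;α,β;q) f = 0` on a set `U ⊆ ℝ`:
`f` is twice differentiable at every point of `U`, with derivatives `f₁`, `f₂`, and
`z(z−1)(z−a_H) f₂ + [γ(z−1)(z−a_H) + δ z(z−a_H) + ε z(z−1)] f₁ + (αβ z + q) f = 0` there.
(No Fuchs relation is built in; `γ+δ+ε = α+β+1` is assumed where a statement needs it.)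
[cite: Umetsu2000, §3 (3.1)] -/
def IsSolutionOn (aH α β γ δ ε q : ℂ) (U : Set ℝ) (f : ℝ → ℂ) : Prop :=
  ∃ f₁ f₂ : ℝ → ℂ, ∀ x ∈ U, HasDerivAt f (f₁ x) x ∧ HasDerivAt f₁ (f₂ x) x ∧
    lead aH x * f₂ x + mid aH γ δ ε x * f₁ x + low α β q x * f x = 0

/-! ### Elementary calculus -/

/-- On an open set, all iterated derivatives of a smooth function are smooth, and each is the
derivative of the previous one. [folklore] -/
private theorem iterate_deriv_smooth {φ : ℝ → ℂ} {U : Set ℝ} (hU : IsOpen U)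
    (hφ : ContDiffOn ℝ ((⊤ : ℕ∞) : WithTop ℕ∞) φ U) (k : ℕ) :
    ContDiffOn ℝ ((⊤ : ℕ∞) : WithTop ℕ∞) (deriv^[k] φ) U ∧
      ∀ r ∈ U, HasDerivAt (deriv^[k] φ) ((deriv^[k + 1] φ) r) r := by
  induction k with
  | zero =>
    refine ⟨hφ, fun r hr => ?_⟩
    rw [Function.iterate_succ_apply']
    exact ((hφ.differentiableOn (by simp)).differentiableAt (hU.mem_nhds hr)).hasDerivAt
  | succ k ih =>
    have h1 : ContDiffOn ℝ ((⊤ : ℕ∞) : WithTop ℕ∞) (deriv^[k + 1] φ) U := by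
      rw [Function.iterate_succ_apply']
      have := (contDiffOn_succ_iff_deriv_of_isOpen (𝕜 := ℝ) (n := ((⊤ : ℕ∞) : WithTop ℕ∞))
        hU).1 (by simpa using ih.1)
      simpa using this.2.2
    refine ⟨h1, fun r hr => ?_⟩
    rw [Function.iterate_succ_apply' (f := deriv) (n := k + 1)]
    exact ((h1.differentiableOn (by simp)).differentiableAt (hU.mem_nhds hr)).hasDerivAt

/-- Differentiating a three-term identity on an open set. [folklore] -/
private theorem deriv_identity3 {U : Set ℝ} (hU : IsOpen U) {u₀ u₁ u₂ u₃ A B C A' B' C' : ℝ → ℂ}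
    (h0 : ∀ r ∈ U, HasDerivAt u₀ (u₁ r) r) (h1 : ∀ r ∈ U, HasDerivAt u₁ (u₂ r) r)
    (h2 : ∀ r ∈ U, HasDerivAt u₂ (u₃ r) r)
    (hA : ∀ r ∈ U, HasDerivAt A (A' r) r) (hB : ∀ r ∈ U, HasDerivAt B (B' r) r)
    (hC : ∀ r ∈ U, HasDerivAt C (C' r) r)
    (hid : ∀ r ∈ U, A r * u₂ r + B r * u₁ r + C r * u₀ r = 0) :
    ∀ r ∈ U, A r * u₃ r + (A' r + B r) * u₂ r + (B' r + C r) * u₁ r + C' r * u₀ r = 0 := by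
  intro r hr
  have hH : HasDerivAt (fun x => A x * u₂ x + B x * u₁ x + C x * u₀ x)
      (A' r * u₂ r + A r * u₃ r + (B' r * u₁ r + B r * u₂ r) + (C' r * u₀ r + C r * u₁ r)) r :=
    (((hA r hr).mul (h2 r hr)).add ((hB r hr).mul (h1 r hr))).add ((hC r hr).mul (h0 r hr))
  have hzero : HasDerivAt (fun x => A x * u₂ x + B x * u₁ x + C x * u₀ x) 0 r := by
    refine (hasDerivAt_const r (0 : ℂ)).congr_of_eventuallyEq ?_
    filter_upwards [hU.mem_nhds hr] with x hx using hid x hx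
  have := hH.unique hzero
  linear_combination this

/-- Differentiating a four-term identity (last coefficient constant) on an open set. [folklore] -/
private theorem deriv_identity4 {U : Set ℝ} (hU : IsOpen U) {u₀ u₁ u₂ u₃ u₄ A B C A' B' C' : ℝ → ℂ} {E : ℂ}
    (h0 : ∀ r ∈ U, HasDerivAt u₀ (u₁ r) r) (h1 : ∀ r ∈ U, HasDerivAt u₁ (u₂ r) r)
    (h2 : ∀ r ∈ U, HasDerivAt u₂ (u₃ r) r) (h3 : ∀ r ∈ U, HasDerivAt u₃ (u₄ r) r)
    (hA : ∀ r ∈ U, HasDerivAt A (A' r) r) (hB : ∀ r ∈ U, HasDerivAt B (B' r) r)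
    (hC : ∀ r ∈ U, HasDerivAt C (C' r) r)
    (hid : ∀ r ∈ U, A r * u₃ r + B r * u₂ r + C r * u₁ r + E * u₀ r = 0) :
    ∀ r ∈ U, A r * u₄ r + (A' r + B r) * u₃ r + (B' r + C r) * u₂ r + (C' r + E) * u₁ r = 0 := by
  intro r hr
  have hH : HasDerivAt (fun x => A x * u₃ x + B x * u₂ x + C x * u₁ x + E * u₀ x)
      (A' r * u₃ r + A r * u₄ r + (B' r * u₂ r + B r * u₃ r) + (C' r * u₁ r + C r * u₂ r) +
        E * u₁ r) r :=
    ((((hA r hr).mul (h3 r hr)).add ((hB r hr).mul (h2 r hr))).add ((hC r hr).mul (h1 r hr))).add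
      ((h0 r hr).const_mul E)
  have hzero : HasDerivAt (fun x => A x * u₃ x + B x * u₂ x + C x * u₁ x + E * u₀ x) 0 r := by
    refine (hasDerivAt_const r (0 : ℂ)).congr_of_eventuallyEq ?_
    filter_upwards [hU.mem_nhds hr] with x hx using hid x hx
  have := hH.unique hzero
  linear_combination this

/-! ### Derivatives of the coefficients -/

/-- The coercion `ℝ → ℂ` has derivative `1`. [folklore] -/
private theorem hasDerivAt_cast (x : ℝ) : HasDerivAt (fun t : ℝ => (t : ℂ)) 1 x := by
  simpa using (hasDerivAt_id x).ofReal_comp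

/-- `d/dz [z(z−1)(z−a_H)] = (z−1)(z−a_H) + z(z−a_H) + z(z−1) = mid a_H 1 1 1` (the derivative of the
leading coefficient entering Umetsu's (3.2)). [cite: Umetsu2000, §3 (3.1)–(3.2)] -/
theorem hasDerivAt_lead (aH : ℂ) (x : ℝ) : HasDerivAt (lead aH) (mid aH 1 1 1 x) x := by
  unfold lead mid
  have h := ((hasDerivAt_cast x).mul ((hasDerivAt_cast x).sub_const 1)).mul
    ((hasDerivAt_cast x).sub_const aH)
  refine h.congr_deriv ?_
  simp only [Pi.mul_apply]
  ring

/-- `d/dz mid = midDeriv` (the derivative of the first-order coefficient entering Umetsu's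
(3.2)). [cite: Umetsu2000, §3 (3.1)–(3.2)] -/
theorem hasDerivAt_mid (aH γ δ ε : ℂ) (x : ℝ) :
    HasDerivAt (mid aH γ δ ε) (midDeriv aH γ δ ε x) x := by
  unfold mid midDeriv
  have hc := hasDerivAt_cast x
  have h := ((((hc.sub_const 1).mul (hc.sub_const aH)).const_mul γ).add
    ((hc.mul (hc.sub_const aH)).const_mul δ)).add ((hc.mul (hc.sub_const 1)).const_mul ε)
  refine h.congr_deriv ?_
  ring

/-- `d/dz midDeriv = 2(γ+δ+ε)` (a constant; second derivative of the first-order coefficient in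
Umetsu's (3.2)). [cite: Umetsu2000, §3 (3.1)–(3.2)] -/
theorem hasDerivAt_midDeriv (aH γ δ ε : ℂ) (x : ℝ) :
    HasDerivAt (midDeriv aH γ δ ε) (2 * (γ + δ + ε)) x := by
  unfold midDeriv
  have hc := hasDerivAt_cast x
  have h := (((((hc.const_mul 2).sub_const 1).sub_const aH).const_mul γ).add
    (((hc.const_mul 2).sub_const aH).const_mul δ)).add (((hc.const_mul 2).sub_const 1).const_mul ε)
  refine h.congr_deriv ?_
  ring

/-- `d/dz (αβ z + q) = αβ` (derivative of the zeroth-order coefficient in Umetsu's (3.2)).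
[cite: Umetsu2000, §3 (3.1)–(3.2)] -/
theorem hasDerivAt_low (α β q : ℂ) (x : ℝ) : HasDerivAt (low α β q) (α * β) x := by
  unfold low
  simpa using ((hasDerivAt_cast x).const_mul (α * β)).add_const q

/-! ### The Leibniz family (Umetsu (3.2) for every `N = k + 1`) -/

/-- From the existential (classical) form of the equation to the `deriv` form, for a smooth
solution on an open set (uniqueness of derivatives). [folklore] -/
private theorem deriv_form_of_isSolutionOn {aH α β γ δ ε q : ℂ} {U : Set ℝ} (hU : IsOpen U) {f : ℝ → ℂ}
    (hsol : IsSolutionOn aH α β γ δ ε q U f) :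
    ∀ x ∈ U, lead aH x * (deriv^[2] f) x + mid aH γ δ ε x * deriv f x + low α β q x * f x = 0 := by
  obtain ⟨f₁, f₂, h⟩ := hsol
  intro x hx
  have h1 : ∀ y ∈ U, deriv f y = f₁ y := fun y hy => (h y hy).1.deriv
  have h2 : deriv (deriv f) x = f₂ x := by
    have hev : deriv f =ᶠ[𝓝 x] f₁ := by
      filter_upwards [hU.mem_nhds hx] with y hy using h1 y hy
    rw [hev.deriv_eq]
    exact (h x hx).2.1.deriv
  have e2 : (deriv^[2] f) x = f₂ x := by
    simpa [Function.iterate_succ_apply', Function.iterate_zero] using h2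
  rw [e2, h1 x hx]
  exact (h x hx).2.2


/-- **The Leibniz family of the general Heun equation.** If `f` is smooth on an open set `U ⊆ ℝ`
and `z(z−1)(z−a_H) f'' + mid f' + (αβ z + q) f = 0` on `U`, then for every `k` (writing
`N = k+1`) and every `z ∈ U`:
`z(z−1)(z−a_H) f^{(N+2)} + [mid + N·(z(z−1)(z−a_H))'] f^{(N+1)}`
`+ [αβ z + q + N·mid' + N(N−1)(3z − 1 − a_H)] f^{(N)} + [N(N−1)(N−2) + N(N−1)(γ+δ+ε) + Nαβ] f^{(N−1)} = 0`.
This is the `N`-fold derivative of the equation (Leibniz rule; `(z(z−1)(z−a_H))'' = 2(3z−1−a_H)`,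
`''' = 6`, `mid'' = 2(γ+δ+ε)`), i.e. Umetsu's display (3.2) before the Fuchs relation is used.
[cite: Umetsu2000, §3 (3.2)] -/
theorem iterate {aH α β γ δ ε q : ℂ} {U : Set ℝ} (hU : IsOpen U) {f : ℝ → ℂ}
    (hf : ContDiffOn ℝ ((⊤ : ℕ∞) : WithTop ℕ∞) f U) (hsol : IsSolutionOn aH α β γ δ ε q U f) :
    ∀ (k : ℕ), ∀ x ∈ U,
      lead aH x * (deriv^[k + 3] f) x +
        (mid aH γ δ ε x + ((k : ℂ) + 1) * mid aH 1 1 1 x) * (deriv^[k + 2] f) x +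
        (low α β q x + ((k : ℂ) + 1) * midDeriv aH γ δ ε x +
            ((k : ℂ) + 1) * (k : ℂ) * (3 * (x : ℂ) - 1 - aH)) * (deriv^[k + 1] f) x +
        (((k : ℂ) + 1) * (k : ℂ) * ((k : ℂ) - 1) + ((k : ℂ) + 1) * (k : ℂ) * (γ + δ + ε) +
            ((k : ℂ) + 1) * (α * β)) * (deriv^[k] f) x = 0 := by
  have hH := deriv_form_of_isSolutionOn hU hsol
  have hD : ∀ j, ∀ x ∈ U, HasDerivAt (deriv^[j] f) ((deriv^[j + 1] f) x) x :=
    fun j => (iterate_deriv_smooth hU hf j).2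
  have hL : ∀ x ∈ U, HasDerivAt (lead aH) (mid aH 1 1 1 x) x := fun x _ => hasDerivAt_lead aH x
  have h31 : ∀ x : ℝ, HasDerivAt (fun t : ℝ => 3 * (t : ℂ) - 1 - aH) 3 x := fun x => by
    simpa using (((hasDerivAt_cast x).const_mul 3).sub_const 1).sub_const aH
  intro k
  induction k with
  | zero =>
    intro x hx
    have h := deriv_identity3 hU (u₀ := f) (u₁ := deriv f) (u₂ := deriv^[2] f)
      (u₃ := deriv^[3] f) (A := lead aH) (B := mid aH γ δ ε) (C := low α β q)
      (hD 0) (hD 1) (hD 2) hL (fun x _ => hasDerivAt_mid aH γ δ ε x)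
      (fun x _ => hasDerivAt_low α β q x) (fun x hx => hH x hx) x hx
    simp only [Nat.cast_zero, zero_add, Function.iterate_one, Function.iterate_zero, id_eq] at h ⊢
    linear_combination h
  | succ k ih =>
    intro x hx
    have hB : ∀ x ∈ U, HasDerivAt (fun t => mid aH γ δ ε t + ((k : ℂ) + 1) * mid aH 1 1 1 t)
        (midDeriv aH γ δ ε x + ((k : ℂ) + 1) * midDeriv aH 1 1 1 x) x := fun x _ =>
      (hasDerivAt_mid aH γ δ ε x).add ((hasDerivAt_mid aH 1 1 1 x).const_mul _)
    have hC : ∀ x ∈ U, HasDerivAt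
        (fun t => low α β q t + ((k : ℂ) + 1) * midDeriv aH γ δ ε t +
          ((k : ℂ) + 1) * (k : ℂ) * (3 * (t : ℂ) - 1 - aH))
        (α * β + ((k : ℂ) + 1) * (2 * (γ + δ + ε)) + ((k : ℂ) + 1) * (k : ℂ) * 3) x := fun x _ =>
      ((hasDerivAt_low α β q x).add ((hasDerivAt_midDeriv aH γ δ ε x).const_mul _)).add
        ((h31 x).const_mul _)
    have h := deriv_identity4 hU (u₀ := deriv^[k] f) (u₁ := deriv^[k + 1] f)
      (u₂ := deriv^[k + 2] f) (u₃ := deriv^[k + 3] f) (u₄ := deriv^[k + 4] f) (A := lead aH)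
      (E := ((k : ℂ) + 1) * (k : ℂ) * ((k : ℂ) - 1) + ((k : ℂ) + 1) * (k : ℂ) * (γ + δ + ε) +
        ((k : ℂ) + 1) * (α * β))
      (hD k) (hD (k + 1)) (hD (k + 2)) (hD (k + 3)) hL hB hC (fun x hx => ih x hx) x hx
    have e1 : midDeriv aH 1 1 1 x = 2 * (3 * (x : ℂ) - 1 - aH) := by unfold midDeriv; ring
    rw [e1] at h
    push_cast at h ⊢
    simp only [add_assoc, Nat.reduceAdd] at h ⊢
    linear_combination h

/-- **Umetsu (3.2), as printed.** Under the Fuchs relation `γ+δ+ε = α+β+1` (which makes `M_z` a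
Heun operator; Umetsu §2, after his radial Heun equation: the relation "γ+δ−1 = σ₊+σ₋−ε … which
is required for Eq. … to be a Heun's equation"), the
`N`-th derivative (`N = k+1 ≥ 1`) of a smooth solution of `M_z(γ,δ,ε;α,β;q) f = 0` satisfies, on `U`,
`z(z−1)(z−a_H) (f^{(N)})'' + [(γ+N)(z−1)(z−a_H) + (δ+N) z(z−a_H) + (ε+N) z(z−1)] (f^{(N)})'`
`+ [ (3N² + (2α+2β−1)N + αβ) z + q − N(N−1)(a_H+1) − N((a_H+1)γ + a_H δ + ε) ] f^{(N)}`
`+ N(N−1+α)(N−1+β) f^{(N−1)} = 0`. [cite: Umetsu2000, §3 (3.2)] -/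
theorem umetsu_identity {aH α β γ δ ε q : ℂ} (hF : γ + δ + ε = α + β + 1) {U : Set ℝ}
    (hU : IsOpen U) {f : ℝ → ℂ} (hf : ContDiffOn ℝ ((⊤ : ℕ∞) : WithTop ℕ∞) f U)
    (hsol : IsSolutionOn aH α β γ δ ε q U f) (k : ℕ) (x : ℝ) (hx : x ∈ U) :
    lead aH x * (deriv^[k + 3] f) x +
      mid aH (γ + ((k : ℂ) + 1)) (δ + ((k : ℂ) + 1)) (ε + ((k : ℂ) + 1)) x * (deriv^[k + 2] f) x +
      ((3 * ((k : ℂ) + 1) ^ 2 + (2 * α + 2 * β - 1) * ((k : ℂ) + 1) + α * β) * (x : ℂ) + q -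
          ((k : ℂ) + 1) * (k : ℂ) * (aH + 1) -
          ((k : ℂ) + 1) * ((aH + 1) * γ + aH * δ + ε)) * (deriv^[k + 1] f) x +
      ((k : ℂ) + 1) * ((k : ℂ) + α) * ((k : ℂ) + β) * (deriv^[k] f) x = 0 := by
  have h := iterate hU hf hsol k x hx
  have eM : mid aH (γ + ((k : ℂ) + 1)) (δ + ((k : ℂ) + 1)) (ε + ((k : ℂ) + 1)) x =
      mid aH γ δ ε x + ((k : ℂ) + 1) * mid aH 1 1 1 x := by
    unfold mid; ring
  have eL : low α β q x + ((k : ℂ) + 1) * midDeriv aH γ δ ε x +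
      ((k : ℂ) + 1) * (k : ℂ) * (3 * (x : ℂ) - 1 - aH) =
      (3 * ((k : ℂ) + 1) ^ 2 + (2 * α + 2 * β - 1) * ((k : ℂ) + 1) + α * β) * (x : ℂ) + q -
        ((k : ℂ) + 1) * (k : ℂ) * (aH + 1) - ((k : ℂ) + 1) * ((aH + 1) * γ + aH * δ + ε) := by
    have hε : ε = α + β + 1 - γ - δ := by linear_combination hF
    unfold low midDeriv; rw [hε]; ring
  have eE : ((k : ℂ) + 1) * (k : ℂ) * ((k : ℂ) - 1) + ((k : ℂ) + 1) * (k : ℂ) * (γ + δ + ε) +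
      ((k : ℂ) + 1) * (α * β) = ((k : ℂ) + 1) * ((k : ℂ) + α) * ((k : ℂ) + β) := by
    rw [hF]; ring
  rw [eM, ← eL, ← eE]
  exact h

/-! ### The transformation theorem: `N = 1 − α` -/

/-- Umetsu's new exponent pair, made explicit: with `α = 1 − N` the relations
`α̃ + β̃ = α + β + 3N`, `α̃β̃ = 3N² + (2α+2β−1)N + αβ` are solved by `α̃ = N+1`, `β̃ = β+N`
(sum). [cite: Umetsu2000, §3 (after (3.2))] -/
theorem newExponents_sum {α β : ℂ} {N : ℕ} (hα : α = 1 - (N : ℂ)) :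
    ((N : ℂ) + 1) + (β + N) = α + β + 3 * N := by
  rw [hα]; ring

/-- Umetsu's new exponent pair, made explicit: with `α = 1 − N`,
`(N+1)(β+N) = 3N² + (2α+2β−1)N + αβ` (product). [cite: Umetsu2000, §3 (after (3.2))] -/
theorem newExponents_prod {α β : ℂ} {N : ℕ} (hα : α = 1 - (N : ℂ)) :
    ((N : ℂ) + 1) * (β + N) = 3 * (N : ℂ) ^ 2 + (2 * α + 2 * β - 1) * N + α * β := by
  rw [hα]; ring

/-- The Fuchs relation is inherited by the shifted parameters:
`(γ+N) + (δ+N) + (ε+N) = (N+1) + (β+N) + 1` when `γ+δ+ε = α+β+1` and `α = 1−N` (so the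
transformed operator is again "another Heun's equation", as Umetsu states).
[cite: Umetsu2000, §3 (paragraph after (3.2))] -/
theorem fuchs_shift {α β γ δ ε : ℂ} {N : ℕ} (hF : γ + δ + ε = α + β + 1)
    (hα : α = 1 - (N : ℂ)) :
    (γ + N) + (δ + N) + (ε + N) = ((N : ℂ) + 1) + (β + N) + 1 := by
  linear_combination hF + hα

/-- Umetsu's shifted accessory parameter
`q̃ = q − N(N−1)(a_H+1) − N((a_H+1)γ + a_H δ + ε)`. [cite: Umetsu2000, §3 (after (3.2))] -/
def shiftedQ (aH γ δ ε q : ℂ) (N : ℕ) : ℂ :=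
  q - (N : ℂ) * ((N : ℂ) - 1) * (aH + 1) - (N : ℂ) * ((aH + 1) * γ + aH * δ + ε)

/-- **Umetsu's differential transformation (the Teukolsky–Starobinsky mechanism for Heun's
equation).** Let `f` be a smooth classical solution of `M_z(γ,δ,ε;α,β;q) f = 0` on an open set
`U ⊆ ℝ`, with the Fuchs relation `γ+δ+ε = α+β+1`, and suppose `α = 1 − N` for an integer `N ≥ 1`.
Then `f̃ = f^{(N)}` is a classical solution on `U` of the Heun equation
`M_z(γ+N, δ+N, ε+N; N+1, β+N; q̃) f̃ = 0`, `q̃ = q − N(N−1)(a_H+1) − N((a_H+1)γ + a_Hδ + ε)` — Umetsu: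
"`f̃(z) = (d/dz)^N f(z)` with `N = 1−α` … satisfies another Heun's equation in which the parameters
are replaced by `γ̃ = γ+N, δ̃ = δ+N, ε̃ = ε+N, q̃ = …` and `α̃, β̃` determined by
`α̃+β̃ = α+β+3N`, `α̃β̃ = 3N²+(2α+2β−1)N+αβ`" (here `α̃ = N+1`, `β̃ = β+N`,
`newExponents_sum/_prod`). For the Kerr–de Sitter radial Teukolsky equation in the Heun
normalisation of [SuzukiTakasugiUmetsu1998] (`α = σ₊ = 2s+1`) and spin `s < 0` this is the case
`N = |2s|`: "These transformations are the Teukolsky–Starobinsky relations".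
[cite: Umetsu2000, §3 (3.1)–(3.2) and the paragraph following] -/
theorem isSolutionOn_iterate_deriv {aH α β γ δ ε q : ℂ} (hF : γ + δ + ε = α + β + 1) {N : ℕ}
    (hN : 1 ≤ N) (hα : α = 1 - (N : ℂ)) {U : Set ℝ} (hU : IsOpen U) {f : ℝ → ℂ}
    (hf : ContDiffOn ℝ ((⊤ : ℕ∞) : WithTop ℕ∞) f U) (hsol : IsSolutionOn aH α β γ δ ε q U f) :
    IsSolutionOn aH ((N : ℂ) + 1) (β + N) (γ + N) (δ + N) (ε + N) (shiftedQ aH γ δ ε q N) U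
      (deriv^[N] f) := by
  obtain ⟨k, rfl⟩ : ∃ k, N = k + 1 := ⟨N - 1, by omega⟩
  have hD : ∀ j, ∀ x ∈ U, HasDerivAt (deriv^[j] f) ((deriv^[j + 1] f) x) x :=
    fun j => (iterate_deriv_smooth hU hf j).2
  refine ⟨deriv^[k + 2] f, deriv^[k + 3] f, fun x hx => ⟨hD (k + 1) x hx, ?_, ?_⟩⟩
  · simpa [add_assoc] using hD (k + 2) x hx
  · have h := umetsu_identity hF hU hf hsol k x hx
    have hk : ((k : ℕ) : ℂ) + 1 = ((k + 1 : ℕ) : ℂ) := by push_cast; ring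
    have eE : ((k : ℂ) + 1) * ((k : ℂ) + α) * ((k : ℂ) + β) = 0 := by
      rw [hα]; push_cast; ring
    have eLow : low ((((k + 1 : ℕ) : ℂ)) + 1) (β + ((k + 1 : ℕ) : ℂ))
        (shiftedQ aH γ δ ε q (k + 1)) x =
        (3 * ((k : ℂ) + 1) ^ 2 + (2 * α + 2 * β - 1) * ((k : ℂ) + 1) + α * β) * (x : ℂ) + q -
          ((k : ℂ) + 1) * (k : ℂ) * (aH + 1) - ((k : ℂ) + 1) * ((aH + 1) * γ + aH * δ + ε) := by
      unfold low shiftedQ; rw [hα]; push_cast; ring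
    rw [eLow]
    rw [eE, zero_mul, add_zero] at h
    push_cast at h ⊢
    simpa [add_assoc] using h

end GeneralHeun

end Literature.Analysis.ODE
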